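import Literature.MathematicalPhysics.QuantumLattice.GrassmannChargeScaling
import HarnessLib

/-!
# The charge operator of a finite Grassmann algebra and the Ward identity of the Gaussian convolution

Topic `MathematicalPhysics/QuantumLattice`; infinitesimal companion of `GrassmannChargeScaling.lean` (covariance of
Salmhofer's `Δ_C` calculus under the charge scalings `ψ(X) ↦ c(X) ψ(X)`).  For charges (weights) `q : Γ → R` the
**charge operator** `chargeOp R q = N_q := Σ_X q(X) ψ(X) ∂/∂ψ(X)` is the even derivation of the Grassmann algebra
generating the one-parameter group of scalings `c = e^{sq}` (on a monomial it multiplies by the total charge).  This file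
proves:

* `grassmannDeriv_mul` — the general GRADED LEIBNIZ RULE `∂_X (ab) = (∂_X a) b + (involute a)(∂_X b)` (Mathlib has only the
  degree-one case `contractLeft_ι_mul`), and `grassmannDeriv_mul_of_involute_eq` for an even left factor;
* `chargeOp_gen` — `N_q ψ(Y) = q(Y) ψ(Y)`; `chargeOp_mul` — `N_q` is a DERIVATION; `chargeOp_pow_eq_zero`,
  `chargeOp_grassmannExp_neg_eq_zero` — a neutral `V` (`N_q V = 0`) has neutral powers and Boltzmann weight `e^{-V}`;
* `grassmannDeriv_chargeOp` — `∂_Y N_q = N_q ∂_Y + q(Y) ∂_Y`; `constPart_chargeOp`; `iterDeriv_chargeOp`;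
  **`kernel_chargeOp`** — `kernel (N_q F) m X = (Σᵢ q(Xᵢ)) · kernel F m X`;
* `grassmannLaplacian_chargeOp` — `Δ_C N_q = N_q Δ_C + Δ_{C_q}` with the CHARGE-WEIGHTED covariance
  `chargeWeighted q C (X, Y) := (q(X) + q(Y)) C(X, Y)`; `grassmannLaplacian_pow_succ_chargeOp`;
  `chargeOp_gaussConv` — `N_q (μ_C ⋆ a) = μ_C ⋆ (N_q a) - Δ_{C_q} (μ_C ⋆ a)`;
* **`chargeOp_effBoltzmann`** — THE WARD IDENTITY OF THE GAUSSIAN CONVOLUTION: for a neutral interaction the effective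
  Boltzmann factor `B = μ_C ⋆ e^{-V}` satisfies `N_q B + Δ_{C_q} B = 0`; on kernels (`kernel_effBoltzmann_ward`):
  `(Σᵢ q(Xᵢ)) · B_m(X) = -(Δ_{C_q} B)_m(X)`; for a charge-conserving covariance (`C_q = 0`) every charged kernel of `B`
  vanishes (`kernel_effBoltzmann_eq_zero_of_chargeWeighted_eq_zero`).

For the seeded Hubbard torus (`q(ψ^±) = ±1`) `C_q` is `±2` times the ANOMALOUS (seed) blocks of the covariance, so the
identity expresses every charged kernel through the seed — the Grassmann form, at finite volume and for Salmhofer's `Δ_C`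
calculus, of the global-`U(1)` Ward identity used for the phase vertex in Salmhofer–Honerkamp–Metzner–Lauscher 2004, §4.2
and Eberlein–Metzner 2014, §III (the effective-action form, with its quadratic term, is filed separately).

## Sources

M. Salmhofer, C. Honerkamp, W. Metzner, O. Lauscher, Prog. Theor. Phys. 112 (2004) 943, §4.2 [`SalmhoferEtAl2004`];
G. Benfatto, A. Giuliani, V. Mastropietro, Ann. Henri Poincaré 7 (2006) 809, §2.1 (symmetry (2)) [`BenfattoGiulianiMastropietro2006`];
M. Salmhofer, *Renormalization* (1999), §4.3 (4.86)–(4.88) [`Salmhofer1999`]; F. A. Berezin, *The Method of Second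
Quantization* (1966), Ch. I §3 [`Berezin1966`].  The statements are routine consequences ("folklore").

## Design

Two definitions (`chargeOp`, `chargeWeighted`), both abbreviation-level; `R` any commutative ring (`[Algebra ℚ R]` where
`exp` / `Δ_C` / kernels occur); `Γ` finite.  The graded Leibniz rule uses Mathlib's parity automorphism
`CliffordAlgebra.involute`.
-/

noncomputable section

namespace Literature.MathematicalPhysics.QuantumLattice

open GrassmannAlgebra

section GradedLeibniz

variable (R : Type*) [CommRing R] {Γ : Type*}

/-- **The graded Leibniz rule** for the left derivative: `∂_X (ab) = (∂_X a) b + (involute a) (∂_X b)`, `involute` the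
parity automorphism `ψ ↦ -ψ` (Berezin 1966, Ch. I §3). [cite: Berezin1966, Ch. I §3] -/
theorem grassmannDeriv_mul (X : Γ) (a b : GrassmannAlgebra R Γ) :
    grassmannDeriv R X (a * b) = grassmannDeriv R X a * b + CliffordAlgebra.involute a * grassmannDeriv R X b := by
  induction a using CliffordAlgebra.left_induction generalizing b with
  | algebraMap r =>
    rw [AlgHom.commutes, grassmannDeriv_algebraMap, zero_mul, zero_add, Algebra.algebraMap_eq_smul_one, smul_mul_assoc,
      one_mul, smul_mul_assoc, one_mul, map_smul]
  | add x y hx hy => rw [add_mul, map_add, hx, hy, map_add, map_add, add_mul, add_mul]; abel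
  | ι_mul x v hx =>
    rw [mul_assoc, grassmannDeriv_ι_mul, hx, grassmannDeriv_ι_mul, map_mul, CliffordAlgebra.involute_ι, sub_mul,
      smul_mul_assoc, mul_add, mul_assoc, neg_mul, neg_mul, mul_assoc]
    abel

/-- The graded Leibniz rule with an EVEN left factor (`involute a = a`) is the plain Leibniz rule. [folklore] -/
theorem grassmannDeriv_mul_of_involute_eq (X : Γ) {a : GrassmannAlgebra R Γ} (ha : CliffordAlgebra.involute a = a)
    (b : GrassmannAlgebra R Γ) :
    grassmannDeriv R X (a * b) = grassmannDeriv R X a * b + a * grassmannDeriv R X b := by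
  rw [grassmannDeriv_mul, ha]

end GradedLeibniz

section ChargeOperator

variable (R : Type*) [CommRing R] {Γ : Type*}

/-- The **charge-weighted covariance** `C_q(X, Y) = (q(X) + q(Y)) C(X, Y)`: the derivative at `s = 0` of the entrywise
rescaled covariances `e^{s(q(X)+q(Y))} C(X, Y)` of `GrassmannChargeScaling.lean`; it vanishes iff `C` pairs only labels of
opposite charge. [folklore] -/
def chargeWeighted (q : Γ → R) (C : Matrix Γ Γ R) : Matrix Γ Γ R :=
  Matrix.of fun X Y => (q X + q Y) * C X Y

/-- Unfolding `chargeWeighted`. [folklore] -/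
@[simp] theorem chargeWeighted_apply (q : Γ → R) (C : Matrix Γ Γ R) (X Y : Γ) :
    chargeWeighted R q C X Y = (q X + q Y) * C X Y := rfl

variable [Fintype Γ] [DecidableEq Γ]

/-- The **charge operator** `N_q = Σ_X q(X) ψ(X) ∂/∂ψ(X)` of the weights `q : Γ → R`: the even derivation of the Grassmann
algebra multiplying each monomial by its total weight — the generator of the charge scalings `ψ(X) ↦ e^{s q(X)} ψ(X)`
(global `U(1)`: `q(ψ^±) = ±1`; BGM 2006 §2.1, symmetry (2)). [folklore] -/
def chargeOp (q : Γ → R) : Module.End R (GrassmannAlgebra R Γ) :=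
  ∑ X, q X • (LinearMap.mulLeft R (gen R X) ∘ₗ grassmannDeriv R X)

/-- Unfolding `chargeOp`. [folklore] -/
theorem chargeOp_apply (q : Γ → R) (a : GrassmannAlgebra R Γ) :
    chargeOp R q a = ∑ X, q X • (gen R X * grassmannDeriv R X a) := by
  simp [chargeOp, LinearMap.mulLeft_apply]

/-- **The charge operator on a generator**: `N_q ψ(Y) = q(Y) ψ(Y)`. [folklore] -/
theorem chargeOp_gen (q : Γ → R) (Y : Γ) : chargeOp R q (gen R Y) = q Y • gen R Y := by
  rw [chargeOp_apply]
  simp only [grassmannDeriv_gen, mul_ite, mul_one, mul_zero, smul_ite, smul_zero, Finset.sum_ite_eq', Finset.mem_univ,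
    if_true]

/-- The charge operator kills scalars. [folklore] -/
theorem chargeOp_algebraMap (q : Γ → R) (r : R) : chargeOp R q (algebraMap R (GrassmannAlgebra R Γ) r) = 0 := by
  simp [chargeOp_apply]

/-- The charge operator kills `1`. [folklore] -/
@[simp] theorem chargeOp_one (q : Γ → R) : chargeOp R q (1 : GrassmannAlgebra R Γ) = 0 := by
  rw [← map_one (algebraMap R (GrassmannAlgebra R Γ)), chargeOp_algebraMap]

/-- The charge operator on a left degree-one factor: `N_q (ι v · c) = (N_q ι v) c + ι v · N_q c`. [folklore] -/
theorem chargeOp_ι_mul (q : Γ → R) (v : Γ → R) (c : GrassmannAlgebra R Γ) :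
    chargeOp R q (ExteriorAlgebra.ι R v * c) = chargeOp R q (ExteriorAlgebra.ι R v) * c + ExteriorAlgebra.ι R v * chargeOp R q c := by
  simp only [chargeOp_apply, grassmannDeriv_ι_mul, grassmannDeriv_ι, Finset.sum_mul, Finset.mul_sum]
  rw [← Finset.sum_add_distrib]
  refine Finset.sum_congr rfl fun X _ => ?_
  have hswap : gen R X * ExteriorAlgebra.ι R v = -(ExteriorAlgebra.ι R v * gen R X) :=
    eq_neg_of_add_eq_zero_left (ExteriorAlgebra.ι_add_mul_swap _ _)
  rw [mul_sub, smul_sub, ← mul_assoc (gen R X), hswap]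
  simp only [Algebra.algebraMap_eq_smul_one, neg_mul, smul_neg, sub_neg_eq_add, mul_one, smul_mul_assoc, mul_smul_comm,
    mul_assoc]

/-- **The charge operator is a derivation**: `N_q (ab) = (N_q a) b + a (N_q b)`. [folklore] -/
theorem chargeOp_mul (q : Γ → R) (a b : GrassmannAlgebra R Γ) :
    chargeOp R q (a * b) = chargeOp R q a * b + a * chargeOp R q b := by
  induction a using CliffordAlgebra.left_induction generalizing b with
  | algebraMap r =>
    rw [chargeOp_algebraMap, zero_mul, zero_add, Algebra.algebraMap_eq_smul_one, smul_mul_assoc, one_mul, smul_mul_assoc,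
      one_mul, map_smul]
  | add x y hx hy => rw [add_mul, map_add, hx, hy, map_add, add_mul, add_mul]; abel
  | ι_mul x v hx =>
    rw [mul_assoc, chargeOp_ι_mul, hx, chargeOp_ι_mul]
    simp only [mul_add, add_mul, mul_assoc, add_assoc]

/-- A derivation killing `V` kills its powers. [folklore] -/
theorem chargeOp_pow_eq_zero (q : Γ → R) {V : GrassmannAlgebra R Γ} (hV : chargeOp R q V = 0) (n : ℕ) :
    chargeOp R q (V ^ n) = 0 := by
  induction n with
  | zero => rw [pow_zero, chargeOp_one]
  | succ n ih => rw [pow_succ, chargeOp_mul, ih, hV, zero_mul, mul_zero, add_zero]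

/-- **A neutral interaction has a neutral Boltzmann weight**: `N_q V = 0 ⇒ N_q e^{-V} = 0`. [folklore] -/
theorem chargeOp_grassmannExp_neg_eq_zero [Algebra ℚ R] (q : Γ → R) {V : GrassmannAlgebra R Γ} (hV : chargeOp R q V = 0) :
    chargeOp R q (grassmannExp (-V)) = 0 := by
  have hV' : chargeOp R q (-V) = 0 := by rw [map_neg, hV, neg_zero]
  rw [grassmannExp, IsNilpotent.exp, map_sum]
  exact Finset.sum_eq_zero fun n _ => by rw [LinearMap.map_smul_of_tower, chargeOp_pow_eq_zero R q hV', smul_zero]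

/-- **Derivatives shift the charge**: `∂_Y N_q = N_q ∂_Y + q(Y) ∂_Y`. [folklore] -/
theorem grassmannDeriv_chargeOp (q : Γ → R) (Y : Γ) (a : GrassmannAlgebra R Γ) :
    grassmannDeriv R Y (chargeOp R q a) = chargeOp R q (grassmannDeriv R Y a) + q Y • grassmannDeriv R Y a := by
  rw [chargeOp_apply, chargeOp_apply, map_sum]
  have h : ∀ X, grassmannDeriv R Y (q X • (gen R X * grassmannDeriv R X a)) =
      q X • (gen R X * grassmannDeriv R X (grassmannDeriv R Y a)) + (if Y = X then q X • grassmannDeriv R X a else 0) := by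
    intro X
    rw [map_smul, grassmannDeriv_gen_mul, grassmannDeriv_grassmannDeriv_comm R Y X, mul_neg, sub_neg_eq_add, smul_add,
      add_comm]
    split_ifs <;> simp
  simp only [h, Finset.sum_add_distrib, Finset.sum_ite_eq, Finset.mem_univ, if_true]

/-- The charge operator produces no constant part. [folklore] -/
theorem constPart_chargeOp (q : Γ → R) (a : GrassmannAlgebra R Γ) : constPart R (chargeOp R q a) = 0 := by
  simp [chargeOp_apply, constPart_gen]

/-- Iterated derivatives shift the charge by the total charge of the string:
`∂_{X_{m-1}}⋯∂_{X_0} N_q = N_q ∂_{X_{m-1}}⋯∂_{X_0} + (Σᵢ q(Xᵢ)) ∂_{X_{m-1}}⋯∂_{X_0}`. [folklore] -/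
theorem iterDeriv_chargeOp (q : Γ → R) {m : ℕ} (X : Fin m → Γ) (a : GrassmannAlgebra R Γ) :
    iterDeriv R X (chargeOp R q a) = chargeOp R q (iterDeriv R X a) + (∑ i, q (X i)) • iterDeriv R X a := by
  induction m generalizing a with
  | zero => simp [iterDeriv]
  | succ m ih =>
    rw [iterDeriv_succ_apply, iterDeriv_succ_apply R X a, grassmannDeriv_chargeOp, map_add, ih, map_smul, Fin.sum_univ_succ,
      add_smul, add_assoc, add_comm ((∑ i : Fin m, q (X i.succ)) • _)]

variable [Algebra ℚ R]

/-- **On kernels the charge operator multiplies by the total charge**: `kernel (N_q F) m X = (Σᵢ q(Xᵢ)) · kernel F m X`.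
[folklore] -/
theorem kernel_chargeOp (q : Γ → R) (F : GrassmannAlgebra R Γ) (m : ℕ) (X : Fin m → Γ) :
    kernel R (chargeOp R q F) m X = (∑ i, q (X i)) * kernel R F m X := by
  rw [kernel, kernel, iterDeriv_chargeOp, map_add, constPart_chargeOp, zero_add, map_smul, smul_eq_mul]
  ring

/-- **The Laplacian shifts the charge by the charge-weighted covariance**: `Δ_C N_q = N_q Δ_C + Δ_{C_q}`. [folklore] -/
theorem grassmannLaplacian_chargeOp (q : Γ → R) (C : Matrix Γ Γ R) (a : GrassmannAlgebra R Γ) :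
    grassmannLaplacian R C (chargeOp R q a) =
      chargeOp R q (grassmannLaplacian R C a) + grassmannLaplacian R (chargeWeighted R q C) a := by
  rw [grassmannLaplacian_apply, grassmannLaplacian_apply, grassmannLaplacian_apply, LinearMap.map_smul_of_tower, ← smul_add]
  congr 1
  rw [map_sum, ← Finset.sum_add_distrib]
  refine Finset.sum_congr rfl fun X _ => ?_
  rw [map_sum, ← Finset.sum_add_distrib]
  refine Finset.sum_congr rfl fun Y _ => ?_
  rw [map_smul, chargeWeighted_apply, grassmannDeriv_chargeOp, map_add, grassmannDeriv_chargeOp, map_smul, smul_add,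
    smul_add, add_assoc, smul_smul, smul_smul, ← add_smul]
  congr 2
  ring

/-- Powers of the Laplacian: `Δ_C^{n+1} N_q = N_q Δ_C^{n+1} + (n + 1) · Δ_{C_q} Δ_C^n` (the two Laplacians commute).
[folklore] -/
theorem grassmannLaplacian_pow_succ_chargeOp (q : Γ → R) (C : Matrix Γ Γ R) (n : ℕ) (a : GrassmannAlgebra R Γ) :
    (grassmannLaplacian R C ^ (n + 1)) (chargeOp R q a) =
      chargeOp R q ((grassmannLaplacian R C ^ (n + 1)) a) +
        ((n + 1 : ℕ) : R) • grassmannLaplacian R (chargeWeighted R q C) ((grassmannLaplacian R C ^ n) a) := by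
  induction n generalizing a with
  | zero => simp [grassmannLaplacian_chargeOp]
  | succ n ih =>
    have hc : grassmannLaplacian R C (grassmannLaplacian R (chargeWeighted R q C) ((grassmannLaplacian R C ^ n) a)) =
        grassmannLaplacian R (chargeWeighted R q C) ((grassmannLaplacian R C ^ (n + 1)) a) := by
      rw [← Module.End.mul_apply, (commute_grassmannLaplacian R C (chargeWeighted R q C)).eq, Module.End.mul_apply,
        ← Module.End.mul_apply (grassmannLaplacian R C) (_ ^ n), ← pow_succ']
    rw [pow_succ', Module.End.mul_apply, ih, map_add, grassmannLaplacian_chargeOp, map_smul, hc,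
      ← Module.End.mul_apply (grassmannLaplacian R C) (_ ^ (n + 1)), ← pow_succ', add_assoc]
    congr 1
    rw [show (((n + 1 + 1 : ℕ) : R)) = 1 + ((n + 1 : ℕ) : R) by push_cast; ring, add_smul, one_smul]

/-- One Laplacian power: `N_q (Δ_C^{j+1} a) = Δ_C^{j+1} (N_q a) - (j + 1) · Δ_{C_q} (Δ_C^j a)`. [folklore] -/
theorem chargeOp_grassmannLaplacian_pow_succ (q : Γ → R) (C : Matrix Γ Γ R) (j : ℕ) (a : GrassmannAlgebra R Γ) :
    chargeOp R q ((grassmannLaplacian R C ^ (j + 1)) a) =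
      (grassmannLaplacian R C ^ (j + 1)) (chargeOp R q a) -
        ((j + 1 : ℕ) : R) • grassmannLaplacian R (chargeWeighted R q C) ((grassmannLaplacian R C ^ j) a) :=
  eq_sub_of_add_eq (grassmannLaplacian_pow_succ_chargeOp R q C j a).symm

omit [Fintype Γ] [DecidableEq Γ] in
/-- The factorial weights re-index: `((j+1)!)⁻¹ · (j+1) · x = (j!)⁻¹ · x`. [folklore] -/
theorem inv_factorial_succ_smul_succ_smul (j : ℕ) (x : GrassmannAlgebra R Γ) :
    (((j + 1).factorial : ℚ)⁻¹) • (((j + 1 : ℕ) : R) • x) = ((j.factorial : ℚ)⁻¹) • x := by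
  rw [Nat.cast_smul_eq_nsmul, ← Nat.cast_smul_eq_nsmul ℚ, smul_smul]
  congr 1
  rw [Nat.factorial_succ]
  push_cast
  field_simp

/-- **The Gaussian convolution shifts the charge**: `N_q (μ_C ⋆ a) = μ_C ⋆ (N_q a) - Δ_{C_q} (μ_C ⋆ a)` — the
infinitesimal form of `gaussConv_map_mulLeft` (differentiate `μ_C ⋆ (S_c a) = S_c (μ_{c⊗c·C} ⋆ a)` at `c = e^{sq}`, `s = 0`,
using the flow equation `∂_s μ_{C_s} ⋆ = Δ_{∂_s C_s} μ_{C_s} ⋆`). [folklore] -/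
theorem chargeOp_gaussConv (q : Γ → R) (C : Matrix Γ Γ R) (a : GrassmannAlgebra R Γ) :
    chargeOp R q (gaussConv R C a) =
      gaussConv R C (chargeOp R q a) - grassmannLaplacian R (chargeWeighted R q C) (gaussConv R C a) := by
  obtain ⟨k, hk⟩ := isNilpotent_grassmannLaplacian R C
  have hk1 : grassmannLaplacian R C ^ (k + 1) = 0 := by rw [pow_succ, hk, zero_mul]
  have hexp : ∀ b : GrassmannAlgebra R Γ, gaussConv R C b =
      ∑ i ∈ Finset.range (k + 1), ((i.factorial : ℚ)⁻¹) • (grassmannLaplacian R C ^ i) b := by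
    intro b
    rw [gaussConv, IsNilpotent.exp_eq_sum hk1]
    simp only [LinearMap.coe_sum, Finset.sum_apply, LinearMap.smul_apply]
  rw [hexp a, hexp (chargeOp R q a), map_sum, map_sum]
  -- split off the `i = 0` terms of the two exponential sums and the (vanishing) `i = k` term of the Laplacian sum
  rw [Finset.sum_range_succ' _ k, Finset.sum_range_succ' (fun i => ((i.factorial : ℚ)⁻¹) • _) k,
    Finset.sum_range_succ (fun i => grassmannLaplacian R (chargeWeighted R q C) (((i.factorial : ℚ)⁻¹) • _)) k]
  simp only [pow_zero, Module.End.one_apply, Nat.factorial_zero, Nat.cast_one, inv_one, one_smul,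
    LinearMap.map_smul_of_tower, hk, LinearMap.zero_apply, smul_zero, chargeOp_grassmannLaplacian_pow_succ,
    smul_sub, Finset.sum_sub_distrib, inv_factorial_succ_smul_succ_smul, map_zero]
  abel

/-- **The Ward identity of the Gaussian convolution**: for a NEUTRAL interaction (`N_q V = 0`) the effective Boltzmann
factor `B = μ_C ⋆ e^{-V}` satisfies `N_q B + Δ_{C_q} B = 0` — the charge of `B` is generated entirely by the
charge-weighted covariance (for `q(ψ^±) = ±1`: by the anomalous blocks; SHML 2004 §4.2, EberleinMetzner 2014 §III, at the
level of the generating functional). [cite: SalmhoferEtAl2004, §4.2] -/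
theorem chargeOp_effBoltzmann (q : Γ → R) (C : Matrix Γ Γ R) {V : GrassmannAlgebra R Γ} (hV : chargeOp R q V = 0) :
    chargeOp R q (effBoltzmann R C V) + grassmannLaplacian R (chargeWeighted R q C) (effBoltzmann R C V) = 0 := by
  rw [effBoltzmann, chargeOp_gaussConv, chargeOp_grassmannExp_neg_eq_zero R q hV, map_zero, zero_sub, neg_add_cancel]

/-- **The Ward identity on kernels**: for a neutral interaction, every kernel of `B = μ_C ⋆ e^{-V}` of total charge
`Q = Σᵢ q(Xᵢ)` satisfies `Q · B_m(X) = -(Δ_{C_q} B)_m(X)` — a charged kernel is `-Q⁻¹` times the contraction of the kernels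
two degrees up with the charge-weighted covariance. [folklore] -/
theorem kernel_effBoltzmann_ward (q : Γ → R) (C : Matrix Γ Γ R) {V : GrassmannAlgebra R Γ} (hV : chargeOp R q V = 0)
    (m : ℕ) (X : Fin m → Γ) :
    (∑ i, q (X i)) * kernel R (effBoltzmann R C V) m X =
      -kernel R (grassmannLaplacian R (chargeWeighted R q C) (effBoltzmann R C V)) m X := by
  rw [← kernel_chargeOp, eq_neg_iff_add_eq_zero, ← kernel_add, chargeOp_effBoltzmann R q C hV, kernel_zero_right]

/-- **Charge conservation of the Boltzmann factor**: if the covariance pairs only labels of opposite charge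
(`C_q = 0`) and the interaction is neutral, every kernel of `B = μ_C ⋆ e^{-V}` of non-zero total charge vanishes (over a
ring without zero divisors). [folklore] -/
theorem kernel_effBoltzmann_eq_zero_of_chargeWeighted_eq_zero [NoZeroDivisors R] (q : Γ → R) {C : Matrix Γ Γ R}
    (hC : chargeWeighted R q C = 0) {V : GrassmannAlgebra R Γ} (hV : chargeOp R q V = 0) {m : ℕ} {X : Fin m → Γ}
    (hX : ∑ i, q (X i) ≠ 0) : kernel R (effBoltzmann R C V) m X = 0 := by
  have h := kernel_effBoltzmann_ward R q C hV m X
  rw [hC, grassmannLaplacian_zero, LinearMap.zero_apply, kernel_zero_right, neg_zero] at h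
  exact (mul_eq_zero.1 h).resolve_left hX

end ChargeOperator

end Literature.MathematicalPhysics.QuantumLattice
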